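import Summits.CriticalPhenomena.PercolationContinuityZ3.Theorems.PercNearOneGluingNoHeavyLowerTailSahiCombMixCylFive
import Summits.CriticalPhenomena.PercolationContinuityZ3.Theorems.PercNearOneGluingNoHeavyLowerTailSahiCombMixFiveSingle
import Summits.CriticalPhenomena.PercolationContinuityZ3.Theorems.PercNearOneGluingNoHeavyLowerTailSahiCombMixG4CellK01234F15A

/-!
# The comb hierarchy for Sahi's `E_k`, LXXXVII: the `|G| = 4` order-4 cell (W0∪[e]; W1∪[e]; W2∪[e]; W34→W4) of comb H-MIX(5) (part B)

Support file of the one-cut programme (crux `NoHeavyLowerTail`, stmt-CriticalPhenomena-4575; cell `prim-masterthm`, seat P3, gen 12;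
`run/shared/lean/prim/prim-masterthm/prim-masterthm-p3/HIERARCHY.md` §20).  When a fresh coordinate `e` is OR-ed into FOUR of five events (`G = {0,1,2,3}`, member `4` untouched), the only
rows of the new ∩-closed family that are not rows of comb H-MIX(4) on a derived quadruple are the top row (SUBTOP(5), `…SahiCombMixSubtopFiveD`) and the order-4 rows with a
PARTIAL slot `W_u ∩ (W_S ∪ [e])` — seven canonical classes, all certified by this seat's LP (kit j132476/j132636/j132637) with `q = 1` certificates (hereditary comb rows off `e` ×
cylinder moments, `…SahiCombMixCylFive`), lifted through `CombPos` and assembled by the generic four-slot cube cell `combPos_four_mixCoord_of_coeffs` (`…SahiCombMixFourSlot`).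
This file: `combPos_g4cell_k0_1_2_34f15`, `sahiE_g4cell_k0_1_2_34f15_nonneg`.  Generated by the seat script `code/lean/emit_g4.py` from `code/lp54/certs/` (every identity re-verified in exact arithmetic at generation time; the generated
`simp only` sets are supersets of what each normalisation needs, hence `linter.unusedSimpArgs` is switched off locally).
HONEST FRAMING: a cell of the hereditary comb class at `n = 5`; nothing here asserts (M⁺-k) or `C_k` for `k ≥ 3`. [this work]
-/

noncomputable section

open scoped Classical

namespace Summit.CriticalPhenomena.PercolationContinuityZ3.Theorems

open Finset Function
open Literature.Combinatorics.Sahi2008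
open Literature.Probability.Percolation.BHK2006 (ind_le_one ind_inter)
open Literature.Probability.Percolation.DecisionTree (ind ind_of_mem ind_of_not_mem ind_nonneg)
open SahiComb
open SahiCombDisjunct (orCoord)
open SahiCombHereditary (CombHereditary)
open SahiMixture (orCoin coinWeight)

variable {ι : Type} [Fintype ι]

namespace SahiCombMix

/-- Slot 0 of the cell. [this work] -/
private theorem kv_k0_1_2_34f15_0 : (![({0} : Finset (Fin 5)), ({1} : Finset (Fin 5)), ({2} : Finset (Fin 5)), ({3, 4} : Finset (Fin 5))] : Fin 4 → Finset (Fin 5)) 0 = ({0} : Finset (Fin 5)) := by decide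

/-- Coin-free part of slot 0. [this work] -/
private theorem fv_k0_1_2_34f15_0 : (({0} : Finset (Fin 5))).filter (fun l => (![true, true, true, true, false] : Fin 5 → Bool) l = false) = (∅ : Finset (Fin 5)) := by decide

/-- Slot 1 of the cell. [this work] -/
private theorem kv_k0_1_2_34f15_1 : (![({0} : Finset (Fin 5)), ({1} : Finset (Fin 5)), ({2} : Finset (Fin 5)), ({3, 4} : Finset (Fin 5))] : Fin 4 → Finset (Fin 5)) 1 = ({1} : Finset (Fin 5)) := by decide

/-- Coin-free part of slot 1. [this work] -/
private theorem fv_k0_1_2_34f15_1 : (({1} : Finset (Fin 5))).filter (fun l => (![true, true, true, true, false] : Fin 5 → Bool) l = false) = (∅ : Finset (Fin 5)) := by decide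

/-- Slot 2 of the cell. [this work] -/
private theorem kv_k0_1_2_34f15_2 : (![({0} : Finset (Fin 5)), ({1} : Finset (Fin 5)), ({2} : Finset (Fin 5)), ({3, 4} : Finset (Fin 5))] : Fin 4 → Finset (Fin 5)) 2 = ({2} : Finset (Fin 5)) := by decide

/-- Coin-free part of slot 2. [this work] -/
private theorem fv_k0_1_2_34f15_2 : (({2} : Finset (Fin 5))).filter (fun l => (![true, true, true, true, false] : Fin 5 → Bool) l = false) = (∅ : Finset (Fin 5)) := by decide

/-- Slot 3 of the cell. [this work] -/
private theorem kv_k0_1_2_34f15_3 : (![({0} : Finset (Fin 5)), ({1} : Finset (Fin 5)), ({2} : Finset (Fin 5)), ({3, 4} : Finset (Fin 5))] : Fin 4 → Finset (Fin 5)) 3 = ({3, 4} : Finset (Fin 5)) := by decide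

/-- Coin-free part of slot 3. [this work] -/
private theorem fv_k0_1_2_34f15_3 : (({3, 4} : Finset (Fin 5))).filter (fun l => (![true, true, true, true, false] : Fin 5 → Bool) l = false) = ({4} : Finset (Fin 5)) := by decide

section Cellk01234f15B

variable (W : Fin 5 → Set (Set ι)) (e : ι) (hWe : ∀ (j : Fin 5) (b : Bool), secAt e b (W j) = W j)
include hWe

/-- **THE ORDER-4 CELL (W0∪[e]; W1∪[e]; W2∪[e]; W34→W4) IS COMB-POSITIVE**: for every finite cube and every `CombHereditary` quintuple `W` of events ignoring `e`, the row of
`(W_j ∪ [G j]{e∈ω})_j`, `G = {0,1,2,3}`, with slot map `['0', '1', '2', '34']` is comb-positive at multidegree `4` (`combPos_four_mixCoord_of_coeffs`: end coefficients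
= hereditary comb rows off `e`, middle coefficients = `combPos_g4_k0_1_2_34f15_C1/2/3`). [this work] -/
theorem combPos_g4cell_k0_1_2_34f15 (hW : CombHereditary W) :
    CombPos (fun _ : ι => 4) (fun p => sahiE (bernoulliWeight p) 4 (fun j => ind (⋂ l ∈ (![({0} : Finset (Fin 5)), ({1} : Finset (Fin 5)), ({2} : Finset (Fin 5)), ({3, 4} : Finset (Fin 5))] : Fin 4 → Finset (Fin 5)) j, orCoord W e (![true, true, true, true, false] : Fin 5 → Bool) l))) := by
  have eS : (fun j => ind (⋂ l ∈ (![({0} : Finset (Fin 5)), ({1} : Finset (Fin 5)), ({2} : Finset (Fin 5)), ({3, 4} : Finset (Fin 5))] : Fin 4 → Finset (Fin 5)) j, orCoord W e (![true, true, true, true, false] : Fin 5 → Bool) l))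
      = fun j => ind (mixCoord e ((fun j => ⋂ l ∈ (![({0} : Finset (Fin 5)), ({1} : Finset (Fin 5)), ({2} : Finset (Fin 5)), ({3, 4} : Finset (Fin 5))] : Fin 4 → Finset (Fin 5)) j, W l) j)
          ((fun j => ⋂ l ∈ ((![({0} : Finset (Fin 5)), ({1} : Finset (Fin 5)), ({2} : Finset (Fin 5)), ({3, 4} : Finset (Fin 5))] : Fin 4 → Finset (Fin 5)) j).filter (fun l => (![true, true, true, true, false] : Fin 5 → Bool) l = false), W l) j)) := by
    funext j; rw [biInter_orCoord_eq_mixCoord]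
  rw [eS]
  refine combPos_four_mixCoord_of_coeffs e (fun j => ⋂ l ∈ (![({0} : Finset (Fin 5)), ({1} : Finset (Fin 5)), ({2} : Finset (Fin 5)), ({3, 4} : Finset (Fin 5))] : Fin 4 → Finset (Fin 5)) j, W l)
    (fun j => ⋂ l ∈ ((![({0} : Finset (Fin 5)), ({1} : Finset (Fin 5)), ({2} : Finset (Fin 5)), ({3, 4} : Finset (Fin 5))] : Fin 4 → Finset (Fin 5)) j).filter (fun l => (![true, true, true, true, false] : Fin 5 → Bool) l = false), W l)
    (fun j b => secAt_biInter W e hWe _ b) (fun j b => secAt_biInter W e hWe _ b)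
    (fun j => Set.biInter_subset_biInter_left (Finset.filter_subset _ _)) ?_ ?_ ?_ ?_ ?_
  · exact hW.row_off e hWe 4 (![({0} : Finset (Fin 5)), ({1} : Finset (Fin 5)), ({2} : Finset (Fin 5)), ({3, 4} : Finset (Fin 5))] : Fin 4 → Finset (Fin 5))
  · exact combPos_g4_k0_1_2_34f15_C1 W e hWe hW
  · exact combPos_g4_k0_1_2_34f15_C2 W e hWe hW
  · exact combPos_g4_k0_1_2_34f15_C3 W e hWe hW
  · exact hW.row_off e hWe 4 (fun j => ((![({0} : Finset (Fin 5)), ({1} : Finset (Fin 5)), ({2} : Finset (Fin 5)), ({3, 4} : Finset (Fin 5))] : Fin 4 → Finset (Fin 5)) j).filter (fun l => (![true, true, true, true, false] : Fin 5 → Bool) l = false))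

/-- Law-level shadow of the cell. [this work] -/
theorem sahiE_g4cell_k0_1_2_34f15_nonneg (hW : CombHereditary W) (p : ι → unitInterval) :
    0 ≤ sahiE (bernoulliWeight p) 4 (fun j => ind (⋂ l ∈ (![({0} : Finset (Fin 5)), ({1} : Finset (Fin 5)), ({2} : Finset (Fin 5)), ({3, 4} : Finset (Fin 5))] : Fin 4 → Finset (Fin 5)) j, orCoord W e (![true, true, true, true, false] : Fin 5 → Bool) l)) :=
  (combPos_g4cell_k0_1_2_34f15 W e hWe hW).nonneg p

end Cellk01234f15B

end SahiCombMix

end Summit.CriticalPhenomena.PercolationContinuityZ3.Theorems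

end
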